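import Mathlib.RingTheory.Valuation.Basic
import Mathlib.LinearAlgebra.Dimension.Finite
import Mathlib.Data.Fintype.Lattice
import Mathlib.Algebra.Group.Pointwise.Set.Basic
import HarnessLib

/-!
# Risometries and riso-triviality of arc sets in affine space (Monreal 2026, §3)

V. Monreal, *Functorial stratifications of singularities in characteristic 0*, arXiv:2606.12554 (June 2026)
[Monreal2026], §3 «Riso-Triviality Spaces and Dimensions» (held text `paper:arxiv-2606.12554`, LaTeX-source
chunks p0009–p0012; «chunk pNNNN Lk» = line k of that chunk). The section is written for a field extension
`K/κ` «admissible over a domain `R` (of arbitrary characteristic)» (p0009 L3; Def. 2.4: `K` algebraically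
closed, spherically complete, residue field `κ` with a section) and for `𝒪_K`-TUPLES of arcs of a `κ`-scheme.
This file types the EMBEDDED, AFFINE, ONE-SET layer of §3 — exactly what Example 3.11 makes explicit for
`𝔸ⁿ_κ`: arcs of `𝔸ⁿ` are coordinate vectors (`𝔸ⁿ_κ(𝒪_K) ≃ (𝒪_K)ⁿ`, p0010 L9), and for arcs `α = (r_i)`,
`β = (r'_i)` based at the origin «`α ∼_rv β ⟺ r_i ≡ r'_i mod I_{v(α)} ∀ i`» (p0010 L13), `v(α) = min_i v(r_i)`
(Def. 3.6, p0009 L52–L54).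

**Valuation convention.** Mathlib valuations `v : Valuation K Γ₀` are MULTIPLICATIVE (`v ≤ 1` = integral,
SMALLER = DEEPER); the source is additive (p0009 L3). Dictionary: the source's `v(α) = min_i v(r_i)` is
`vnorm v α = max_i v(α i)`; «`v(α − β) > v(α)`» is `vnorm v (α − β) < vnorm v α`; the ideal `I_{>γ}` (Def. 3.2)
is `{v < g}` and the closed valuative ball of radius `γ` around an arc `c` (Def. 3.5, `θ_γ⁻¹θ_γ(c)`) is
`ball v c g = {a | vnorm v (a − c) < g}` with `g ↔ γ` (`g ≤ 1 ↔ γ ≥ 0`; `g = 1` is the ball `B_{𝔸ⁿ,c}` of all arcs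
with the same base point as `c`).

**What is here (all definitions REAL, all lemmas PROVED; nothing asserted about the source's theorems).**
* `Riso.vnorm`, `Riso.RvEq` — Def. 3.6 / Def. 3.9 in the coordinates of Ex. 3.11; Lemma 3.10 (`RvEq` is an
  equivalence relation: `RvEq.refl/symm/trans`, and `RvEq.vnorm_eq`); the rv-class of `0` is `{0}`.
* `Riso.IsDominant v i δ` («the `i`-th coordinate strictly leads») — an rv-class invariant used to read
  directional information off rv-classes (Ex. 3.11: «the rv-relation recovers directional information»);
  `IsDominant.of_rvEq`. (Bookkeeping notion, ours.)
* `Riso.ball` — Def. 3.5 for `𝔸ⁿ`.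
* `Riso.IsRisometry v A A' φ` — Def. 3.15 verbatim: a bijection `φ : A → A'` with
  `rv(φ a − φ b) = rv(a − b)`; Rem. 3.16 proved: distances preserved (`vnorm_sub_eq`), translations
  (`isRisometry_add_const`), compositions (`comp`), inverses (`symm`), restriction, and «a function … that
  preserves rv-classes of differences is automatically a risometry to its image» (`isRisometry_image_of_rvEq`).
* `Riso.subspacePoints κ W` (`W(K)` for a `κ`-linear subspace `W ⊂ 𝔸ⁿ_κ`, i.e. `W : Submodule κ (Fin n → κ)`),
  `Riso.subspaceBall v κ W g` = `B_{W,0}(γ)`; `Riso.IsTranslationInvariantOn` — Def. 3.14 for one set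
  («`𝒜|_B` non-trivial» and «`A + B_{W,0}(γ) = A`»); `Riso.IsRisoTrivialOn` — Def. 3.17 for one set (a
  risometry of `A ∩ B` onto some `C ⊂ B` that is `W`-translation-invariant on `B`; «`A` is `W`-riso-trivial on `B`
  when the singleton `{A}` is», p0010 L79); `Riso.rtd v κ A c g` — the riso-triviality dimension
  `rtd_B(A) = max dim_κ V` over the `V` for which `A` is `V`-riso-trivial on `B` (Def. 3.17).
* consumer lemmas: `IsRisoTrivialOn.anti` (smaller subspaces), `isRisoTrivialOn_bot`, `rtd_eq_zero_of`
  (no non-zero `W` is riso-trivial ⇒ `rtd = 0`), and the TRANSPORT STEP `IsRisoTrivialOn.exists_rvEq_smul`: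
  a `W`-straightener turns every translation vector `s·w`, `w ∈ W`, `‖s·w‖ < g`, at every arc `a ∈ A ∩ B`, into an
  arc `b ∈ A ∩ B` with `rv(b − a) = rv(s·w)`.
* (v2) invariances: `ball_eq_of_vnorm_sub_lt` (a ball is determined by any of its points), `isRisoTrivialOn_congr_centre` /
  `rtd_congr_centre`; `IsRisoTrivialOn.add_const` / `rtd_image_add_const` (translations transport straighteners).

**Generality and what is NOT here.** Everything is stated for an arbitrary commutative ring `K` with a
valuation and an arbitrary coefficient field `κ` with `[Algebra κ K]`; the source's standing admissibility
hypotheses (Def. 2.4) are NOT imposed by the definitions (they matter for the source's theorems, none of which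
is typed here). Not here: `𝒪_K`-tuples with several members and valuative closedness (Def. 3.7/3.8), arcs of
general `κ`-schemes (Def. 3.1–3.5 beyond `𝔸ⁿ`), adapted straighteners (Lemma 3.22, Prop. 3.23), the
riso-triviality SPACE `rtsp` and its intrinsic version (Def. 4.5/4.7), Thm. 4.13. Requested as a Literature
home by route `Summits/ResolutionOfSingularities/…/Theses/RisoStrata.lean` («DEFINITION REQUESTS … wanted
later … vendoring Monreal Defs 3.1–3.17»); first consumer: the kernel upgrade of barrier
`Literature.Barriers.ResolutionOfSingularities.RisoBlindAlongInseparableOrbit` (cell res-hironaka, D-0089).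
AI transcription of a LaTeX source; nothing here bears on resolution of singularities in any characteristic.
-/

noncomputable section

open scoped Pointwise

namespace Literature.AlgebraicGeometry.Resolution

namespace Riso

open Finset

variable {K : Type*} [CommRing K] {Γ₀ : Type*} [LinearOrderedCommGroupWithZero Γ₀] (v : Valuation K Γ₀) {n : ℕ}

/-! ### Def. 3.6 / Ex. 3.11: the valuative size of a coordinate vector -/

/-- The valuative size `‖δ‖_v = max_i v(δ i)` of a vector `δ ∈ Kⁿ` (multiplicative convention) — the source's
valuative order `v(α) = min_{l ∈ 𝔪} v(α(l))` of an arc of `𝔸ⁿ` based at the origin, computed on the coordinates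
(Def. 3.6, p0009 L49–L54; Ex. 3.11, p0010 L6–L13). [cite: Monreal2026, Def. 3.6 and Ex. 3.11] -/
def vnorm (δ : Fin n → K) : Γ₀ := univ.sup fun i => v (δ i)

/-- Each coordinate is bounded by the valuative size. [cite: Monreal2026, Def. 3.6] -/
theorem le_vnorm (δ : Fin n → K) (i : Fin n) : v (δ i) ≤ vnorm v δ :=
  Finset.le_sup (f := fun i => v (δ i)) (mem_univ i)

/-- `‖δ‖ ≤ g` iff every coordinate has valuation `≤ g`. [cite: Monreal2026, Def. 3.6] -/
theorem vnorm_le_iff {δ : Fin n → K} {g : Γ₀} : vnorm v δ ≤ g ↔ ∀ i, v (δ i) ≤ g := by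
  simp [vnorm, Finset.sup_le_iff]

/-- `‖δ‖ < g` iff every coordinate has valuation `< g` (`g > 0`). [cite: Monreal2026, Def. 3.6] -/
theorem vnorm_lt_iff {δ : Fin n → K} {g : Γ₀} (hg : 0 < g) : vnorm v δ < g ↔ ∀ i, v (δ i) < g := by
  rw [vnorm, Finset.sup_lt_iff (bot_eq_zero (α := Γ₀) ▸ hg)]
  simp

/-- The valuative size is attained at some coordinate. [cite: Monreal2026, Def. 3.6] -/
theorem exists_vnorm_eq [NeZero n] (δ : Fin n → K) : ∃ i, vnorm v δ = v (δ i) := by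
  obtain ⟨i, -, h⟩ := exists_mem_eq_sup (univ : Finset (Fin n)) univ_nonempty (fun i => v (δ i))
  exact ⟨i, h⟩

/-- `‖0‖ = 0`. [cite: Monreal2026, Def. 3.6] -/
@[simp] theorem vnorm_zero : vnorm v (0 : Fin n → K) = 0 := by
  simp [vnorm]

/-- `‖δ‖ = 0` iff every coordinate has valuation `0` (over a field: `δ = 0`). [cite: Monreal2026, Def. 3.6] -/
theorem vnorm_eq_zero_iff {δ : Fin n → K} : vnorm v δ = 0 ↔ ∀ i, v (δ i) = 0 := by
  constructor
  · intro h i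
    exact le_antisymm (h ▸ le_vnorm v δ i) zero_le
  · intro h
    exact le_antisymm ((vnorm_le_iff v).2 fun i => (h i).le) zero_le

/-- `‖−δ‖ = ‖δ‖`. [cite: Monreal2026, Def. 3.6] -/
theorem vnorm_neg (δ : Fin n → K) : vnorm v (-δ) = vnorm v δ := by
  simp [vnorm]

/-- `‖δ − δ'‖ = ‖δ' − δ‖` (the valuative distance of Def. 3.6 is symmetric). [cite: Monreal2026, Def. 3.6] -/
theorem vnorm_sub_comm (δ δ' : Fin n → K) : vnorm v (δ - δ') = vnorm v (δ' - δ) := by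
  rw [← neg_sub, vnorm_neg]

/-- Ultrametric inequality for the valuative size. [cite: Monreal2026, Def. 3.6] -/
theorem vnorm_add_le (δ δ' : Fin n → K) : vnorm v (δ + δ') ≤ max (vnorm v δ) (vnorm v δ') := by
  refine (vnorm_le_iff v).2 fun i => ?_
  exact (v.map_add (δ i) (δ' i)).trans (max_le_max (le_vnorm v δ i) (le_vnorm v δ' i))

/-- Ultrametric inequality, difference form. [cite: Monreal2026, Def. 3.6] -/
theorem vnorm_sub_le (δ δ' : Fin n → K) : vnorm v (δ - δ') ≤ max (vnorm v δ) (vnorm v δ') := by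
  simpa [sub_eq_add_neg, vnorm_neg] using vnorm_add_le v δ (-δ')

/-- Strict ultrametric case: adding a strictly deeper vector does not change the size.
[cite: Monreal2026, Def. 3.6] -/
theorem vnorm_add_eq_of_lt {δ δ' : Fin n → K} (h : vnorm v δ' < vnorm v δ) : vnorm v (δ + δ') = vnorm v δ := by
  refine le_antisymm ((vnorm_add_le v δ δ').trans (max_le le_rfl h.le)) ?_
  have : vnorm v δ ≤ max (vnorm v (δ + δ')) (vnorm v (-δ')) := by
    simpa using vnorm_add_le v (δ + δ') (-δ')
  rw [vnorm_neg] at this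
  rcases le_max_iff.1 this with h1 | h1
  · exact h1
  · exact absurd h1 (not_le.2 h)

/-- `‖s·δ‖ = v(s)·‖δ‖`. [cite: Monreal2026, Def. 3.6] -/
theorem vnorm_smul (s : K) (δ : Fin n → K) : vnorm v (s • δ) = v s * vnorm v δ := by
  simp only [vnorm, Pi.smul_apply, smul_eq_mul, map_mul]
  rw [Finset.apply_sup_eq_sup_comp (s := univ) (f := fun i => v (δ i)) (v s * ·)
    (fun x y => (max_mul_mul_left (v s) x y).symm) (by simp [bot_eq_zero])]
  rfl

/-! ### Def. 3.9 / Ex. 3.11: the rv-relation on arcs of `𝔸ⁿ` based at the origin -/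

/-- The **rv-relation** (Def. 3.9, p0009 L70–L73: «`α ∼_rv β ⟺` both arcs have the same base point and
(`v(α,β) > v(α)`) ∨ (`α = β`)»), for arcs of `𝔸ⁿ` based at the origin written in coordinates as in Ex. 3.11
(p0010 L11–L13: «`α ∼_rv β ⟺ r_i ≡ r'_i mod I_{v(α)} ∀ i`»): `δ ∼ δ'` iff `δ = δ'` or `‖δ − δ'‖ < ‖δ‖`.
[cite: Monreal2026, Def. 3.9 and Ex. 3.11] -/
def RvEq (δ δ' : Fin n → K) : Prop := δ = δ' ∨ vnorm v (δ - δ') < vnorm v δ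

variable {v}

/-- Lemma 3.10: reflexivity. [cite: Monreal2026, Lemma 3.10] -/
protected theorem RvEq.refl (δ : Fin n → K) : RvEq v δ δ := Or.inl (Eq.refl δ)

/-- rv-equivalent vectors have the same valuative size (the step «`v(α(l)) = v(β(l))` … `v(α) = v(β)`» of the
proof of Lemma 3.10, p0010 L2–L3). [cite: Monreal2026, Lemma 3.10] -/
theorem RvEq.vnorm_eq {δ δ' : Fin n → K} (h : RvEq v δ δ') : vnorm v δ' = vnorm v δ := by
  rcases h with rfl | h
  · rfl
  · have : δ' = δ + -(δ - δ') := by abel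
    rw [this, vnorm_add_eq_of_lt v (by rwa [vnorm_neg])]

/-- Lemma 3.10: symmetry. [cite: Monreal2026, Lemma 3.10] -/
theorem RvEq.symm {δ δ' : Fin n → K} (h : RvEq v δ δ') : RvEq v δ' δ := by
  have hn := h.vnorm_eq
  rcases h with rfl | h'
  · exact RvEq.refl δ
  · exact Or.inr (by rw [vnorm_sub_comm, hn]; exact h')

/-- Lemma 3.10: transitivity. [cite: Monreal2026, Lemma 3.10] -/
theorem RvEq.trans {δ δ' δ'' : Fin n → K} (h : RvEq v δ δ') (h' : RvEq v δ' δ'') : RvEq v δ δ'' := by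
  rcases h with rfl | h₁
  · exact h'
  rcases h' with rfl | h₂
  · exact Or.inr h₁
  refine Or.inr ?_
  have : δ - δ'' = (δ - δ') + (δ' - δ'') := by abel
  rw [this]
  refine lt_of_le_of_lt (vnorm_add_le v _ _) (max_lt h₁ ?_)
  rwa [RvEq.vnorm_eq (Or.inr h₁ : RvEq v δ δ')] at h₂

/-- Lemma 3.10, symmetric form. [cite: Monreal2026, Lemma 3.10] -/
theorem rvEq_comm {δ δ' : Fin n → K} : RvEq v δ δ' ↔ RvEq v δ' δ := ⟨RvEq.symm, RvEq.symm⟩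

/-- The rv-class of the zero arc is `{0}` (Def. 3.9 with `v(0) = ∞`). [cite: Monreal2026, Def. 3.9] -/
theorem rvEq_zero_left_iff {δ : Fin n → K} : RvEq v 0 δ ↔ δ = 0 := by
  constructor
  · rintro (h | h)
    · exact h.symm
    · simp at h
  · rintro rfl; exact RvEq.refl 0

/-- rv-equivalent vectors vanish together. [cite: Monreal2026, Def. 3.9] -/
theorem RvEq.eq_zero_iff {δ δ' : Fin n → K} (h : RvEq v δ δ') : δ = 0 ↔ δ' = 0 := by
  constructor
  · rintro rfl; exact (rvEq_zero_left_iff.1 h)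
  · rintro rfl; exact (rvEq_zero_left_iff.1 h.symm)

/-- The non-trivial clause of Def. 3.9 as a constructor. [cite: Monreal2026, Def. 3.9] -/
theorem RvEq.of_vnorm_sub_lt {δ δ' : Fin n → K} (h : vnorm v (δ - δ') < vnorm v δ) : RvEq v δ δ' := Or.inr h

/-- Scaling an rv-equivalence by a scalar of non-zero valuation: `δ ∼ δ' ⇒ s·δ ∼ s·δ'`.
[cite: Monreal2026, Def. 3.9] -/
theorem RvEq.smul {δ δ' : Fin n → K} (h : RvEq v δ δ') {s : K} (hs : v s ≠ 0) : RvEq v (s • δ) (s • δ') := by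
  rcases h with rfl | h
  · exact RvEq.refl _
  · refine Or.inr ?_
    rw [← smul_sub, vnorm_smul, vnorm_smul]
    exact (mul_lt_mul_iff_of_pos_left (lt_of_le_of_ne zero_le hs.symm)).2 h

variable (v)

/-! ### «the `i`-th coordinate leads»: an rv-class invariant -/

/-- `δ` is **`i`-dominant** if its `i`-th coordinate is strictly shallower than every other coordinate
(`v(δ j) < v(δ i)` for `j ≠ i`), i.e. `rv(δ) = rv(δ_i e_i)`: the rv-class «points in the direction `e_i`».
Bookkeeping notion for reading directions off rv-classes (Ex. 3.11: «the rv-relation recovers directional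
information with respect to base points», p0010 L11). [cite: Monreal2026, Ex. 3.11] -/
def IsDominant (i : Fin n) (δ : Fin n → K) : Prop := ∀ j, j ≠ i → v (δ j) < v (δ i)

variable {v}

namespace IsDominant

/-- The size of an `i`-dominant vector is the valuation of its `i`-th coordinate. [cite: Monreal2026, Ex. 3.11] -/
theorem vnorm_eq {i : Fin n} {δ : Fin n → K} (h : IsDominant v i δ) : vnorm v δ = v (δ i) := by
  refine le_antisymm ((vnorm_le_iff v).2 fun j => ?_) (le_vnorm v δ i)
  by_cases hj : j = i
  · rw [hj]
  · exact (h j hj).le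

/-- `i`-dominance only depends on the rv-class. [cite: Monreal2026, Ex. 3.11] -/
theorem of_rvEq {i : Fin n} {δ δ' : Fin n → K} (h : IsDominant v i δ) (h' : RvEq v δ δ') : IsDominant v i δ' := by
  rcases h' with rfl | hlt
  · exact h
  rw [h.vnorm_eq] at hlt
  have hcoord : ∀ j, v (δ j - δ' j) < v (δ i) := fun j =>
    lt_of_le_of_lt (le_vnorm v (δ - δ') j) hlt
  have hi : v (δ' i) = v (δ i) := by
    have : δ' i = δ i + -(δ i - δ' i) := by ring
    rw [this]
    exact v.map_add_eq_of_lt_left (by rw [Valuation.map_neg]; exact hcoord i)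
  intro j hj
  have : δ' j = δ j + -(δ j - δ' j) := by ring
  rw [hi, this]
  exact lt_of_le_of_lt (v.map_add _ _) (max_lt (h j hj) (by rw [Valuation.map_neg]; exact hcoord j))

/-- `i`-dominance is invariant under non-zero-valued scalars. [cite: Monreal2026, Ex. 3.11] -/
theorem smul_iff {i : Fin n} {δ : Fin n → K} {s : K} (hs : v s ≠ 0) : IsDominant v i (s • δ) ↔ IsDominant v i δ := by
  simp only [IsDominant, Pi.smul_apply, smul_eq_mul, map_mul]
  have hs' : 0 < v s := lt_of_le_of_ne zero_le hs.symm
  exact forall₂_congr fun j _ => mul_lt_mul_iff_of_pos_left hs'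

/-- Distinct dominant coordinates are incompatible. [cite: Monreal2026, Ex. 3.11] -/
theorem eq_of_isDominant {i j : Fin n} {δ : Fin n → K} (hi : IsDominant v i δ) (hj : IsDominant v j δ) : i = j := by
  by_contra hij
  exact lt_asymm (hi j (Ne.symm hij)) (hj i hij)

end IsDominant

variable (v)

/-! ### Def. 3.5: valuative balls of `𝔸ⁿ` -/

/-- The valuative ball of `𝔸ⁿ` around the arc `c` of (multiplicative) radius `g`: `{a | ‖a − c‖ < g}`. For `c`
integral and `g ≤ 1` this is `B_{𝔸ⁿ,c}(γ) = θ_γ⁻¹θ_γ(c)` (Def. 3.5, p0009 L31–L35; Def. 3.2/3.3: `θ_γ` reduces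
coordinates modulo `I_{>γ} = {v > γ}`), `g ↔ γ`; `g = 1` gives `B_{𝔸ⁿ,c}` = all arcs with the base point of `c`.
[cite: Monreal2026, Def. 3.5] -/
def ball (c : Fin n → K) (g : Γ₀) : Set (Fin n → K) := {a | vnorm v (a - c) < g}

variable {v}

/-- Membership in a ball. [cite: Monreal2026, Def. 3.5] -/
theorem mem_ball_iff {c : Fin n → K} {g : Γ₀} {a : Fin n → K} : a ∈ ball v c g ↔ vnorm v (a - c) < g := Iff.rfl

/-- A non-empty ball has positive radius. [cite: Monreal2026, Def. 3.5] -/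
theorem pos_of_mem_ball {c : Fin n → K} {g : Γ₀} {a : Fin n → K} (h : a ∈ ball v c g) : 0 < g :=
  lt_of_le_of_lt zero_le h

/-- Two arcs of a ball are at valuative distance `< g` (balls are ultrametric). [cite: Monreal2026, Def. 3.5] -/
theorem vnorm_sub_lt_of_mem_ball {c : Fin n → K} {g : Γ₀} {a b : Fin n → K} (ha : a ∈ ball v c g)
    (hb : b ∈ ball v c g) : vnorm v (a - b) < g := by
  have : a - b = (a - c) - (b - c) := by abel
  rw [this]
  exact lt_of_le_of_lt (vnorm_sub_le v _ _) (max_lt ha hb)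

/-- Translating an arc of a ball by a vector of size `< g` stays in the ball. [cite: Monreal2026, Def. 3.5] -/
theorem add_mem_ball {c : Fin n → K} {g : Γ₀} {a t : Fin n → K} (ha : a ∈ ball v c g) (ht : vnorm v t < g) :
    a + t ∈ ball v c g := by
  rw [mem_ball_iff, add_sub_right_comm]
  exact lt_of_le_of_lt (vnorm_add_le v _ _) (max_lt ha ht)

variable (v)

/-! ### Def. 3.15: risometries -/

/-- **Risometry** (Def. 3.15, p0010 L64–L69: «Let `A, A' ⊂ 𝔸ⁿ_κ(𝒪_K)` be infinitesimal subsets. A set-theoretic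
bijection `φ : A → A'` is a risometry, if for every `a,b ∈ A`: `rv(φ(a) − φ(b)) = rv(a − b)`»): `φ` restricts
to a bijection `A → A'` and preserves the rv-classes of differences. (Infinitesimality of `A`, `A'` — all arcs
with one base point — is a hypothesis on the sets, not part of this predicate.) [cite: Monreal2026, Def. 3.15] -/
def IsRisometry (A A' : Set (Fin n → K)) (φ : (Fin n → K) → (Fin n → K)) : Prop :=
  Set.BijOn φ A A' ∧ ∀ a ∈ A, ∀ b ∈ A, RvEq v (φ a - φ b) (a - b)

variable {v}

namespace IsRisometry

variable {A A' : Set (Fin n → K)} {φ : (Fin n → K) → (Fin n → K)}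

/-- The underlying bijection. [cite: Monreal2026, Def. 3.15] -/
theorem bijOn (h : IsRisometry v A A' φ) : Set.BijOn φ A A' := h.1

/-- rv-classes of differences are preserved. [cite: Monreal2026, Def. 3.15] -/
theorem rvEq (h : IsRisometry v A A' φ) {a b : Fin n → K} (ha : a ∈ A) (hb : b ∈ A) :
    RvEq v (φ a - φ b) (a - b) := h.2 a ha b hb

/-- The image of a risometry is its target. [cite: Monreal2026, Def. 3.15] -/
theorem image_eq (h : IsRisometry v A A' φ) : φ '' A = A' := h.1.image_eq

/-- Rem. 3.16: «Risometries preserve valuative distances.» [cite: Monreal2026, Rem. 3.16] -/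
theorem vnorm_sub_eq (h : IsRisometry v A A' φ) {a b : Fin n → K} (ha : a ∈ A) (hb : b ∈ A) :
    vnorm v (φ a - φ b) = vnorm v (a - b) :=
  ((h.rvEq ha hb).vnorm_eq).symm

/-- A risometry restricts to a risometry of any subset onto its image. [cite: Monreal2026, Rem. 3.16] -/
theorem restrict (h : IsRisometry v A A' φ) {S : Set (Fin n → K)} (hS : S ⊆ A) : IsRisometry v S (φ '' S) φ :=
  ⟨(h.1.injOn.mono hS).bijOn_image, fun a ha b hb => h.2 a (hS ha) b (hS hb)⟩

/-- Rem. 3.16: «Compositions … of risometries are risometries.» [cite: Monreal2026, Rem. 3.16] -/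
theorem comp {A'' : Set (Fin n → K)} {ψ : (Fin n → K) → (Fin n → K)} (hψ : IsRisometry v A' A'' ψ)
    (hφ : IsRisometry v A A' φ) : IsRisometry v A A'' (ψ ∘ φ) :=
  ⟨hψ.1.comp hφ.1, fun a ha b hb =>
    (hψ.2 _ (hφ.1.mapsTo ha) _ (hφ.1.mapsTo hb)).trans (hφ.2 a ha b hb)⟩

/-- Rem. 3.16: «… inverses of risometries are risometries» (the inverse realised by `Function.invFunOn φ A`).
[cite: Monreal2026, Rem. 3.16] -/
theorem symm (h : IsRisometry v A A' φ) [Nonempty (Fin n → K)] : IsRisometry v A' A (Function.invFunOn φ A) := by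
  refine ⟨h.1.symm h.1.invOn_invFunOn.symm, fun a' ha' b' hb' => ?_⟩
  obtain ⟨a, ha, rfl⟩ := h.1.surjOn ha'
  obtain ⟨b, hb, rfl⟩ := h.1.surjOn hb'
  rw [h.1.invOn_invFunOn.1 ha, h.1.invOn_invFunOn.1 hb]
  exact (h.2 a ha b hb).symm

end IsRisometry

/-- Rem. 3.16: «A function with infinitesimal domain that preserves rv-classes of differences is automatically a
risometry to its image» — injectivity is automatic because the rv-class of `0` is `{0}`.
[cite: Monreal2026, Rem. 3.16] -/
theorem isRisometry_image_of_rvEq {A : Set (Fin n → K)} {φ : (Fin n → K) → (Fin n → K)}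
    (h : ∀ a ∈ A, ∀ b ∈ A, RvEq v (φ a - φ b) (a - b)) : IsRisometry v A (φ '' A) φ := by
  refine ⟨Set.InjOn.bijOn_image fun a ha b hb hab => ?_, h⟩
  have := (h a ha b hb).eq_zero_iff.1 (sub_eq_zero.2 hab)
  exact sub_eq_zero.1 this

/-- Rem. 3.16: «Translations are risometries.» [cite: Monreal2026, Rem. 3.16] -/
theorem isRisometry_add_const (A : Set (Fin n → K)) (t : Fin n → K) :
    IsRisometry v A ((· + t) '' A) (· + t) :=
  isRisometry_image_of_rvEq fun a _ b _ => by rw [add_sub_add_right_eq_sub]; exact RvEq.refl _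

/-- The identity is a risometry. [cite: Monreal2026, Rem. 3.16] -/
theorem isRisometry_id (A : Set (Fin n → K)) : IsRisometry v A A id :=
  ⟨Set.bijOn_id A, fun _ _ _ _ => RvEq.refl _⟩

/-! ### Def. 3.14 / Def. 3.17: translation invariance, riso-triviality and `rtd` -/

variable (κ : Type*) [Field κ] [Algebra κ K] (v)

/-- `W(K)`: the `K`-points of a `κ`-linear subspace `W ⊂ 𝔸ⁿ_κ` (§3.2 fixes coordinates `𝔸ⁿ_κ = Spec κ[x_1,…,x_n]`,
p0010 L55; `W ⊂ 𝔸ⁿ_κ` «a `κ`-linear subspace», Def. 3.14) — the `K`-span of the image of `W` under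
`κⁿ → Kⁿ`. [cite: Monreal2026, Def. 3.14] -/
def subspacePoints (W : Submodule κ (Fin n → κ)) : Submodule K (Fin n → K) :=
  Submodule.span K ((fun w i => algebraMap κ K (w i)) '' (W : Set (Fin n → κ)))

/-- `B_{W,0}(γ)`: the closed valuative ball of radius `γ ↔ g` of the `κ`-scheme `W` around its zero arc (Def. 3.5
applied to `Z = W`), i.e. the arcs of `W` of valuative size `< g`. [cite: Monreal2026, Def. 3.14] -/
def subspaceBall (W : Submodule κ (Fin n → κ)) (g : Γ₀) : Set (Fin n → K) :=
  {w | w ∈ subspacePoints κ W ∧ vnorm v w < g}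

/-- **`W`-translation-invariance on the ball `B = ball v c g`** for ONE set `C` (Def. 3.14, p0010 L57–L62, with
`𝒜 = {C}`): «`𝒜|_B` is a non-trivial `𝒪_K`-tuple such that `A + B_{W,0}(γ) = A` for every `A ∈ 𝒜|_B`, where
`γ ∈ Γ` is the radius of `B`» — here: `C ∩ B ≠ ∅` and `(C ∩ B) + B_{W,0}(γ) = C ∩ B`.
[cite: Monreal2026, Def. 3.14] -/
def IsTranslationInvariantOn (C : Set (Fin n → K)) (c : Fin n → K) (g : Γ₀) (W : Submodule κ (Fin n → κ)) :
    Prop :=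
  (C ∩ ball v c g).Nonempty ∧ (C ∩ ball v c g) + subspaceBall v κ W g = C ∩ ball v c g

/-- **`W`-riso-triviality of ONE set `A` on the ball `B = ball v c g`** (Def. 3.17, p0010 L74–L79, with
`𝒜 = {A}`: «there exists a risometry `φ : supp(𝒜|_B) → C`, with `C ⊂ B`, such that `φ(𝒜|_B)` is
`W`-translation-invariant on `B`»; «We say that `A ⊂ 𝔸ⁿ_κ(𝒪_K)` is `W`-riso-trivial on `B` when the singleton
`{A}` is»): some risometry maps `A ∩ B` onto a `C ⊂ B` that is `W`-translation-invariant on `B` (such a `φ` is a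
«`W`-straightener of `A` on `B`»). [cite: Monreal2026, Def. 3.17] -/
def IsRisoTrivialOn (A : Set (Fin n → K)) (c : Fin n → K) (g : Γ₀) (W : Submodule κ (Fin n → κ)) : Prop :=
  ∃ (φ : (Fin n → K) → (Fin n → K)) (C : Set (Fin n → K)),
    C ⊆ ball v c g ∧ IsRisometry v (A ∩ ball v c g) C φ ∧ IsTranslationInvariantOn v κ C c g W

/-- **Riso-triviality dimension** of ONE set `A` on the ball `B = ball v c g` (Def. 3.17, p0010 L75–L77:
«`rtd_B(𝒜) := max_{V ⊂ 𝔸ⁿ_κ, 𝒜 is V-riso-trivial} dim_κ V`»), as the supremum in `ℕ` of the `κ`-dimensions of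
the `κ`-subspaces `V` for which `A` is `V`-riso-trivial on `B` (`0` if there is none, i.e. if `A ∩ B = ∅`).
[cite: Monreal2026, Def. 3.17] -/
def rtd (A : Set (Fin n → K)) (c : Fin n → K) (g : Γ₀) : ℕ :=
  sSup {d | ∃ W : Submodule κ (Fin n → κ), IsRisoTrivialOn v κ A c g W ∧ Module.finrank κ W = d}

variable {v κ}

/-- `W(K)` of the zero subspace is zero. [cite: Monreal2026, Def. 3.14] -/
@[simp] theorem subspacePoints_bot : subspacePoints (K := K) κ (⊥ : Submodule κ (Fin n → κ)) = ⊥ := by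
  rw [subspacePoints, Submodule.bot_coe, Set.image_singleton]
  have : (fun i => algebraMap κ K ((0 : Fin n → κ) i)) = 0 := by ext; simp
  rw [this, Submodule.span_zero_singleton]

/-- `0 ∈ B_{W,0}(γ)` (positive radius). [cite: Monreal2026, Def. 3.14] -/
theorem zero_mem_subspaceBall (W : Submodule κ (Fin n → κ)) {g : Γ₀} (hg : 0 < g) :
    (0 : Fin n → K) ∈ subspaceBall v κ W g :=
  ⟨Submodule.zero_mem _, by simpa using hg⟩

/-- `B_{W',0}(γ) ⊆ B_{W,0}(γ)` for `W' ≤ W`. [cite: Monreal2026, Def. 3.14] -/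
theorem subspaceBall_mono {W W' : Submodule κ (Fin n → κ)} (hW : W' ≤ W) (g : Γ₀) :
    subspaceBall v κ W' g ⊆ subspaceBall v κ W g := fun _ ⟨h1, h2⟩ =>
  ⟨Submodule.span_mono (Set.image_mono hW) h1, h2⟩

/-- `B_{W,0}(γ)` is symmetric. [cite: Monreal2026, Def. 3.14] -/
theorem neg_mem_subspaceBall {W : Submodule κ (Fin n → κ)} {g : Γ₀} {t : Fin n → K} (ht : t ∈ subspaceBall v κ W g) :
    -t ∈ subspaceBall v κ W g :=
  ⟨Submodule.neg_mem _ ht.1, by rw [vnorm_neg]; exact ht.2⟩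

/-- The small multiples `s·w` (`‖s·w‖ < g`) of (the image in `Kⁿ` of) a vector `w ∈ W` lie in `B_{W,0}(γ)`.
[cite: Monreal2026, Def. 3.14] -/
theorem smul_mem_subspaceBall {W : Submodule κ (Fin n → κ)} {w : Fin n → κ} (hw : w ∈ W) (s : K) {g : Γ₀}
    (hs : vnorm v (s • fun i => algebraMap κ K (w i)) < g) :
    (s • fun i => algebraMap κ K (w i)) ∈ subspaceBall v κ W g :=
  ⟨Submodule.smul_mem _ s (Submodule.subset_span ⟨w, hw, rfl⟩), hs⟩

namespace IsTranslationInvariantOn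

variable {C : Set (Fin n → K)} {c : Fin n → K} {g : Γ₀} {W : Submodule κ (Fin n → κ)}

/-- Non-triviality clause of Def. 3.14. [cite: Monreal2026, Def. 3.14] -/
theorem nonempty (h : IsTranslationInvariantOn v κ C c g W) : (C ∩ ball v c g).Nonempty := h.1

/-- The radius is positive. [cite: Monreal2026, Def. 3.14] -/
theorem pos (h : IsTranslationInvariantOn v κ C c g W) : 0 < g := by
  obtain ⟨a, -, ha⟩ := h.1
  exact pos_of_mem_ball ha

/-- `A + B_{W,0}(γ) = A`, elementwise: translates by `B_{W,0}(γ)` stay in `C ∩ B`. [cite: Monreal2026, Def. 3.14] -/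
theorem add_mem (h : IsTranslationInvariantOn v κ C c g W) {a t : Fin n → K} (ha : a ∈ C ∩ ball v c g)
    (ht : t ∈ subspaceBall v κ W g) : a + t ∈ C ∩ ball v c g := by
  rw [← h.2]
  exact Set.add_mem_add ha ht

/-- `W`-translation-invariance implies `W'`-translation-invariance for `W' ≤ W`. [cite: Monreal2026, Def. 3.14] -/
theorem anti (h : IsTranslationInvariantOn v κ C c g W) {W' : Submodule κ (Fin n → κ)} (hW : W' ≤ W) :
    IsTranslationInvariantOn v κ C c g W' := by
  refine ⟨h.1, Set.Subset.antisymm ?_ fun a ha => ?_⟩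
  · rintro _ ⟨a, ha, t, ht, rfl⟩
    exact h.add_mem ha (subspaceBall_mono hW g ht)
  · exact ⟨a, ha, 0, zero_mem_subspaceBall W' h.pos, add_zero a⟩

end IsTranslationInvariantOn

namespace IsRisoTrivialOn

variable {A : Set (Fin n → K)} {c : Fin n → K} {g : Γ₀} {W : Submodule κ (Fin n → κ)}

/-- A riso-trivial set meets the ball. [cite: Monreal2026, Def. 3.17] -/
theorem nonempty (h : IsRisoTrivialOn v κ A c g W) : (A ∩ ball v c g).Nonempty := by
  obtain ⟨φ, C, -, hφ, hT⟩ := h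
  obtain ⟨x, hx, -⟩ := hT.1
  obtain ⟨a, ha, -⟩ := hφ.1.surjOn hx
  exact ⟨a, ha⟩

/-- `W`-riso-trivial ⇒ `W'`-riso-trivial for `W' ≤ W` (same straightener). [cite: Monreal2026, Def. 3.17] -/
theorem anti (h : IsRisoTrivialOn v κ A c g W) {W' : Submodule κ (Fin n → κ)} (hW : W' ≤ W) :
    IsRisoTrivialOn v κ A c g W' := by
  obtain ⟨φ, C, hC, hφ, hT⟩ := h
  exact ⟨φ, C, hC, hφ, hT.anti hW⟩

/-- **Transport step.** If `A` is `W`-riso-trivial on `B` then for every arc `a ∈ A ∩ B`, every `w ∈ W` and every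
scalar `s` with `‖s·w‖ < g` there is an arc `b ∈ A ∩ B` with `rv(b − a) = rv(s·w)`: push `a` through the
straightener, translate by `s·w ∈ B_{W,0}(γ)` inside the straightened set, pull back, and use Def. 3.15.
(derived here) [cite: Monreal2026, Def. 3.14–3.17] -/
theorem exists_rvEq_smul (h : IsRisoTrivialOn v κ A c g W) {w : Fin n → κ} (hw : w ∈ W) {a : Fin n → K}
    (ha : a ∈ A ∩ ball v c g) (s : K) (hs : vnorm v (s • fun i => algebraMap κ K (w i)) < g) :
    ∃ b ∈ A ∩ ball v c g, RvEq v (b - a) (s • fun i => algebraMap κ K (w i)) := by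
  obtain ⟨φ, C, hC, hφ, hT⟩ := h
  have hφa : φ a ∈ C ∩ ball v c g := ⟨hφ.1.mapsTo ha, hC (hφ.1.mapsTo ha)⟩
  have hmem := hT.add_mem hφa (smul_mem_subspaceBall hw s hs)
  obtain ⟨b, hb, hbeq⟩ := hφ.1.surjOn hmem.1
  refine ⟨b, hb, ?_⟩
  have := hφ.rvEq hb ha
  rw [hbeq, add_sub_cancel_left] at this
  exact this.symm

end IsRisoTrivialOn

/-- The zero subspace is riso-trivial on every ball meeting `A` (the identity as straightener;
`B_{0,0}(γ) = {0}`). [cite: Monreal2026, Def. 3.17] -/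
theorem isRisoTrivialOn_bot {A : Set (Fin n → K)} {c : Fin n → K} {g : Γ₀} (hne : (A ∩ ball v c g).Nonempty) :
    IsRisoTrivialOn v κ A c g (⊥ : Submodule κ (Fin n → κ)) := by
  refine ⟨id, A ∩ ball v c g, Set.inter_subset_right, isRisometry_id _, hne.mono (by simp), ?_⟩
  have hT : subspaceBall v κ (⊥ : Submodule κ (Fin n → κ)) g = {0} := by
    ext t
    simp only [subspaceBall, subspacePoints_bot, Submodule.mem_bot, Set.mem_setOf_eq, Set.mem_singleton_iff]
    constructor
    · rintro ⟨h1, -⟩; exact h1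
    · rintro rfl
      obtain ⟨a, -, ha⟩ := hne
      exact ⟨rfl, by simpa using pos_of_mem_ball ha⟩
  rw [Set.inter_eq_left.2 Set.inter_subset_right, hT, Set.add_singleton]
  simp

/-- **`rtd = 0` criterion**: if no non-zero `κ`-subspace `W` makes `A` `W`-riso-trivial on `B`, then
`rtd_B(A) = 0`. [cite: Monreal2026, Def. 3.17] -/
theorem rtd_eq_zero_of {A : Set (Fin n → K)} {c : Fin n → K} {g : Γ₀}
    (h : ∀ W : Submodule κ (Fin n → κ), W ≠ ⊥ → ¬ IsRisoTrivialOn v κ A c g W) : rtd v κ A c g = 0 := by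
  rw [rtd]
  rcases Set.eq_empty_or_nonempty {d | ∃ W : Submodule κ (Fin n → κ), IsRisoTrivialOn v κ A c g W ∧
      Module.finrank κ W = d} with he | hne
  · rw [he, csSup_empty]; rfl
  · refine le_antisymm (csSup_le hne ?_) (Nat.zero_le _)
    rintro d ⟨W, hW, rfl⟩
    by_cases hb : W = ⊥
    · subst hb; rw [finrank_bot]
    · exact absurd hW (h W hb)

/-! ### Invariances (v2): the ball only matters up to its centre's class; translations transport riso-triviality

Two elementary instances of the source's «riso-triviality … is intrinsic» theme (§4.1: Prop. 4.2–4.4, Cor. 4.6 concern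
isomorphisms of complete local rings; here only the trivial set-theoretic cases needed downstream are recorded): a valuative
ball is determined by ANY of its points (ultrametric), so `IsRisoTrivialOn`/`rtd` on `ball v c g` depend on `c` only through
the ball; and a translation `a ↦ a + t` (a risometry, Rem. 3.16) transports straighteners. -/

/-- Ultrametric balls: if `‖c − c'‖ < g` then `ball v c g = ball v c' g` (every point of a ball is a centre).
[cite: Monreal2026, Def. 3.5] -/
theorem ball_eq_of_vnorm_sub_lt {c c' : Fin n → K} {g : Γ₀} (h : vnorm v (c - c') < g) : ball v c g = ball v c' g := by
  ext a
  simp only [mem_ball_iff]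
  constructor
  · intro ha
    have : a - c' = (a - c) + (c - c') := by abel
    rw [this]; exact lt_of_le_of_lt (vnorm_add_le v _ _) (max_lt ha h)
  · intro ha
    have : a - c = (a - c') - (c - c') := by abel
    rw [this]; exact lt_of_le_of_lt (vnorm_sub_le v _ _) (max_lt ha h)

/-- `W`-translation-invariance on a ball depends on the centre only through the ball. [cite: Monreal2026, Def. 3.14] -/
theorem isTranslationInvariantOn_congr_centre {C : Set (Fin n → K)} {c c' : Fin n → K} {g : Γ₀}
    (h : vnorm v (c - c') < g) (W : Submodule κ (Fin n → κ)) :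
    IsTranslationInvariantOn v κ C c g W ↔ IsTranslationInvariantOn v κ C c' g W := by
  unfold IsTranslationInvariantOn
  rw [ball_eq_of_vnorm_sub_lt h]

/-- `W`-riso-triviality on a ball depends on the centre only through the ball. [cite: Monreal2026, Def. 3.17] -/
theorem isRisoTrivialOn_congr_centre {A : Set (Fin n → K)} {c c' : Fin n → K} {g : Γ₀} (h : vnorm v (c - c') < g)
    (W : Submodule κ (Fin n → κ)) : IsRisoTrivialOn v κ A c g W ↔ IsRisoTrivialOn v κ A c' g W := by
  unfold IsRisoTrivialOn IsTranslationInvariantOn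
  rw [ball_eq_of_vnorm_sub_lt h]

/-- `rtd` on a ball depends on the centre only through the ball. [cite: Monreal2026, Def. 3.17] -/
theorem rtd_congr_centre {A : Set (Fin n → K)} {c c' : Fin n → K} {g : Γ₀} (h : vnorm v (c - c') < g) :
    rtd v κ A c g = rtd v κ A c' g := by
  unfold rtd
  simp only [isRisoTrivialOn_congr_centre (κ := κ) h]

/-- Translating a ball: `(· + t) '' ball v c g = ball v (c + t) g`. [cite: Monreal2026, Def. 3.5] -/
theorem image_add_const_ball (c t : Fin n → K) (g : Γ₀) : (· + t) '' ball v c g = ball v (c + t) g := by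
  ext a
  simp only [Set.mem_image, mem_ball_iff]
  constructor
  · rintro ⟨b, hb, rfl⟩
    rwa [add_sub_add_right_eq_sub]
  · intro ha
    refine ⟨a - t, ?_, sub_add_cancel a t⟩
    rwa [show a - t - c = a - (c + t) by abel]

/-- **Translations transport riso-triviality** (Rem. 3.16: translations are risometries): if `A` is `W`-riso-trivial on
`ball v c g` then `A + t` is `W`-riso-trivial on `ball v (c + t) g`, with the same straightened set translated by `t`.
[cite: Monreal2026, Rem. 3.16 and Def. 3.17] -/
theorem IsRisoTrivialOn.add_const {A : Set (Fin n → K)} {c : Fin n → K} {g : Γ₀} {W : Submodule κ (Fin n → κ)}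
    (h : IsRisoTrivialOn v κ A c g W) (t : Fin n → K) : IsRisoTrivialOn v κ ((· + t) '' A) (c + t) g W := by
  obtain ⟨φ, C, hC, hφ, hT⟩ := h
  have hAt : (· + t) '' A ∩ ball v (c + t) g = (· + t) '' (A ∩ ball v c g) := by
    rw [Set.image_inter (add_left_injective t), image_add_const_ball]
  refine ⟨fun a => φ (a - t) + t, (· + t) '' C, ?_, ?_, ?_⟩
  · rw [← image_add_const_ball]; exact Set.image_mono hC
  · rw [hAt]
    refine ⟨⟨?_, ?_, ?_⟩, ?_⟩
    · rintro _ ⟨a, ha, rfl⟩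
      exact ⟨φ a, hφ.bijOn.mapsTo ha, by simp⟩
    · rintro _ ⟨a, ha, rfl⟩ _ ⟨b, hb, rfl⟩ hab
      simp only [add_sub_cancel_right, add_left_inj] at hab
      rw [hφ.bijOn.injOn ha hb hab]
    · rintro _ ⟨x, hx, rfl⟩
      obtain ⟨a, ha, rfl⟩ := hφ.bijOn.surjOn hx
      exact ⟨a + t, ⟨a, ha, rfl⟩, by simp⟩
    · rintro _ ⟨a, ha, rfl⟩ _ ⟨b, hb, rfl⟩
      simp only [add_sub_cancel_right, add_sub_add_right_eq_sub]
      exact hφ.rvEq ha hb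
  · have hCt : (· + t) '' C ∩ ball v (c + t) g = (· + t) '' (C ∩ ball v c g) := by
      rw [Set.image_inter (add_left_injective t), image_add_const_ball]
    refine ⟨?_, ?_⟩
    · rw [hCt]; exact hT.nonempty.image _
    · rw [hCt]
      ext x
      constructor
      · rintro ⟨_, ⟨a, ha, rfl⟩, s, hs, rfl⟩
        exact ⟨a + s, hT.add_mem ha hs, by simp only; abel⟩
      · rintro ⟨a, ha, rfl⟩
        exact ⟨a + t, ⟨a, ha, rfl⟩, 0, zero_mem_subspaceBall W hT.pos, by simp⟩

/-- `rtd` is translation-invariant: `rtd_{B+t}(A + t) = rtd_B(A)`. [cite: Monreal2026, Rem. 3.16 and Def. 3.17] -/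
theorem rtd_image_add_const {A : Set (Fin n → K)} {c : Fin n → K} {g : Γ₀} (t : Fin n → K) :
    rtd v κ ((· + t) '' A) (c + t) g = rtd v κ A c g := by
  unfold rtd
  congr 1
  ext d
  constructor
  · rintro ⟨W, hW, rfl⟩
    refine ⟨W, ?_, rfl⟩
    have h' := hW.add_const (-t)
    have hA : (· + -t) '' ((· + t) '' A) = A := by
      rw [Set.image_image]; simp
    rwa [hA, add_neg_cancel_right] at h'
  · rintro ⟨W, hW, rfl⟩
    exact ⟨W, hW.add_const t, rfl⟩

end Riso

end Literature.AlgebraicGeometry.Resolution
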